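import Summits.Schanuel.Schanuel.Theorems.RootDecomp1EUntwistedWall04

/-!
# RootDecomp1EUntwistedWall — lens 2, generation 41 «THE UNTWISTED 1-FOLD WALL BY TERM-COUNTING» (lane (P1) of critic RULING L1949 (5); GO + CHECKLIST E-g41 L1993; VERDICT L2040: CLEARED — ONE CELL (E-R18 (a″)) mod hE): `S` ITSELF with surplus one at the UNTWISTED twins `zTwin k β (q·ρ)` (`ρ` hyper-Liouville, `q ∈ ℚ^×`, `β ∈ ℚ(i) ∖ ℚ`, every `k ≥ 1`) and on the whole Gauss-curve class `InGaussCurveClass`, modulo the ONE registered published theorem `hE = EHLM2015_thm_2_1` (Ernvall-Hytönen–Leppälä–Matala-aho 2015, Thm 2.1, typed as a WEAKER few-term consequence over Gaussian-rational exponents) — «count TERMS, not DEGREE» — continuation (RootDecomp1EUntwistedWall05): §12 `lambdaH_ne_pow_of_dyadicHyper₂` (hypothesis-free Diophantine lemma from the tree λ_H measures), `not_inLWClass_zU`, `zU_separation` (HYPOTHESIS-FREE) + §13 `linearIndependent_zU`, `zU_Estable`, `item25020_at_zU`, `item31409_at_zU`, LiveItems probes (the two `Iff.rfl` read-backs left to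 the tree's `RootDecomp1EGenericScale05`)

(lens-2 g41 HOME kernel UntwistedWall.lean 8d50f5c1…, 1431 l, import tree `RootDecomp1EWallDichotomy01` ONLY; Ctrl 1a8646c2… rc 1 at exactly nine lines C1–C9; Probe 491b1be0…; NODE-g41.md ab32189b…; NODE L2035 / REQUEST L2036 / ERRATUM L2037; writer re-check L2039; critic VERDICT L2040 (crit g8): CLEARED — ONE CELL (E-R18 (a″)) to lens-2, conditional «mod hE»; lens-2 tally cells ×3; RULE E-R19; PORT GO 01–0k `--supports stmt-Schanuel-31409`, statements/proofs verbatim, part 01 docstring of `EHLM2015_thm_2_1` amended by the critic's representation sentence and the `+1 → +2` exponent bookkeeping.)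
PORTED for the decomp-schanuel cell by the census instrument (gen 17), no census credit beyond the cell of record. Split in five parts for the 400-line cap (NODE §7 plan 01–04 with §1–§8 halved): 01 = §1 the registered fact `EHLM2015_thm_2_1` (the ONLY `def … : Prop` binder) + §2–§5 collapse data / identities / Lipschitz bound / distinct exponents and term count; 02 = §6–§8 integrality, sizes, endgame; 03 = §9 THE ENGINE `algebraicIndependent_gaussPt` (+ the kernel's module docstring); 04 = §10–§11 twins, the class `InGaussCurveClass`, the cells `cell_25020` / `cell_31409`, the member `z_U` and its separation from the point / scale / two-scale classes; 05 = §12–§13 the hypothesis-free Diophantine lemma `lambdaH_ne_pow_of_dyadicHyper₂`, `not_inLWClass_zU`, `zU_separation`, and the LIVE-item probes at `z_U`.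
PORT EDITS (statements and proofs otherwise VERBATIM): every undocumented helper received a one-line docstring; the tree-twin one-liners `isAlgebraic_I'`, `I_not_mem_range'`, `lambdaH_transcendental`, `lambdaH_ne_zero'`, `lambdaH_pos'`, `algebraicIndependent_tail'`, `abs_pow_succ_sub_le'` made `private` (copied privately into later parts where used); the two `Iff.rfl` READ-BACKS `defectOneSchanuel_iff` / `eStableDefectOne_iff` of K §13 are NOT re-landed (identical read-backs are already in the tree: `RootDecomp1EGenericScale05.defectOneSchanuel_iff` / `.eStableDefectOne_iff`); the positional probes `item25020_at_zU`, `item31409_at_zU`, `cell_25020_of_defectOneSchanuel`, `eStableDefectOne_at_zU (h : EStableDefectOne)`, `eStableDefectOne_body_at_zU_of_hE` are kept. Items 31409 / 25020 / 31410 stay OPEN (rung 0); nothing here proves `S`.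
-/

noncomputable section

open Complex Polynomial IntermediateField
open scoped BigOperators

open Summit.Schanuel.Schanuel.Theorems.RootDecomp1KHyper (SB SFset exists_ball_eval_ne_zero
  exists_int_mul_eq_map mvaeval_int_map sb_of_algebraicIndependent mem_adjoin_SFset_I')
open Summit.Schanuel.Schanuel.Theorems.RootDecomp1KHyper.HyperCell (HyperLiouville lambdaH
  hyperLiouville_lambdaH hexp one_le_hexp summable_lambdaH)
open Summit.Schanuel.Schanuel.Theorems.RootDecomp1ELWTransport (zTwin zTwin_left zTwin_right
  linearIndependent_zTwin dblMoments InLWClass DyadicHyper₂)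
open Summit.Schanuel.Schanuel.Theorems.RootDecomp1EScaleTransfer (InScaleClass HyperScaleApprox)
open Summit.Schanuel.Schanuel.Theorems.RootDecomp1ETwoScale (CoveredTower InTwoScaleClass)
open Summit.Schanuel.Schanuel.Theorems.RootDecomp1EPointTransfer (InPointClass lambdaH_rat_lower
  lambdaH_sub_rat_lower)
open Summit.Schanuel.Schanuel.Theorems.RootDecomp1EWallDichotomy (InTwistedFrameClass transcendental_complex
  transcendental_of_hyperLiouville not_linearIndependent_zTwin_ratCast twinExpo twinExpo_left twinExpo_right)
open Summit.Schanuel.Schanuel.Theorems.RootDecomp1BHyperFrame (trdeg_adjoin_le_of_isAlgebraic')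
open Summit.Schanuel.Schanuel.Theorems.RootDecomp1BDefectFloorCells (natCast_le_trdeg_of_algebraicIndependent)

namespace Summit.Schanuel.Schanuel.Theorems.RootDecomp1EUntwistedWall

variable {n : ℕ}

/-- `λ_H` is transcendental (tree: hyper-Liouville ⇒ transcendental; private copy in `ℂ`). -/
private theorem lambdaH_transcendental : Transcendental ℚ (lambdaH : ℂ) :=
  transcendental_complex (transcendental_of_hyperLiouville hyperLiouville_lambdaH)

/-! ## §12  Separation of the member from g39's LW class — a hypothesis-free Diophantine lemma -/

/-- `|a^{n+1} − b^{n+1}| ≤ (n+1) M^n |a − b|` for `|a|, |b| ≤ M`. -/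
private theorem abs_pow_succ_sub_le' {a b M : ℝ} (ha : |a| ≤ M) (hb : |b| ≤ M) (n : ℕ) :
    |a ^ (n + 1) - b ^ (n + 1)| ≤ ((n : ℝ) + 1) * M ^ n * |a - b| := by
  have hM : 0 ≤ M := (abs_nonneg a).trans ha
  induction n with
  | zero => simp
  | succ n ih =>
      have e : a ^ (n + 1 + 1) - b ^ (n + 1 + 1) = a * (a ^ (n + 1) - b ^ (n + 1)) + (a - b) * b ^ (n + 1) := by
        ring
      have h1 : |a| * |a ^ (n + 1) - b ^ (n + 1)| ≤ M * (((n : ℝ) + 1) * M ^ n * |a - b|) :=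
        mul_le_mul ha ih (abs_nonneg _) hM
      have h2 : |a - b| * |b| ^ (n + 1) ≤ |a - b| * M ^ (n + 1) :=
        mul_le_mul_of_nonneg_left (pow_le_pow_left₀ (abs_nonneg b) hb (n + 1)) (abs_nonneg _)
      calc |a ^ (n + 1 + 1) - b ^ (n + 1 + 1)|
          = |a * (a ^ (n + 1) - b ^ (n + 1)) + (a - b) * b ^ (n + 1)| := by rw [e]
        _ ≤ |a * (a ^ (n + 1) - b ^ (n + 1))| + |(a - b) * b ^ (n + 1)| := abs_add_le _ _
        _ = |a| * |a ^ (n + 1) - b ^ (n + 1)| + |a - b| * |b| ^ (n + 1) := by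
            rw [abs_mul, abs_mul, abs_pow]
        _ ≤ M * (((n : ℝ) + 1) * M ^ n * |a - b|) + |a - b| * M ^ (n + 1) := add_le_add h1 h2
        _ = (((n + 1 : ℕ) : ℝ) + 1) * M ^ (n + 1) * |a - b| := by push_cast; ring

/-- `0 < λ_H` (positive series, tree `summable_lambdaH`). -/
private theorem lambdaH_pos' : 0 < lambdaH :=
  summable_lambdaH.tsum_pos (fun k => by positivity) 0 (by positivity)

/-- **`λ_H` is not a positive power `T^{J}` (`J ≥ 1`) of a dyadic 2-fold hyper-Liouville `T > 0`** (the scale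
datum of g39's `InLWClass`).  A dyadic approximation `|T − p/2^μ| < exp(−exp(2^{mμ}))` gives
`|λ_H − r| ≤ J(T+1)^{J−1} exp(−exp(2^{mμ}))` at the rational `r = (p/2^μ)^J`, `den r ≤ 2^{μJ}`, against the
TREE's irrationality measures of `λ_H`: `exp(−exp(den(r)³)) ≤ |λ_H − r|` for `den r ≥ 2`
(`lambdaH_rat_lower`, PointTransfer04) and `1/32 ≤ |λ_H − r|` for `den r = 1` (`lambdaH_sub_rat_lower`, K = 0). -/
theorem lambdaH_ne_pow_of_dyadicHyper₂ {T : ℝ} (hT2 : DyadicHyper₂ T) (hT0 : 0 < T) (j : ℕ) :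
    lambdaH ≠ T ^ (j + 1) := by
  intro hTJ
  -- the integer-denominator constant
  obtain ⟨c₀, hc₀, hc₀1, hint⟩ : ∃ c₀ : ℝ, 0 < c₀ ∧ c₀ ≤ 1 ∧ ∀ r : ℚ, r.den = 1 → c₀ ≤ |lambdaH - r| := by
    refine ⟨1 / (2 * ((2 : ℝ) ^ hexp (0 + 1)) ^ 2), by positivity, ?_, fun r hr =>
      lambdaH_sub_rat_lower (K := 0) r ?_⟩
    · rw [div_le_one (by positivity)]
      have : (1 : ℝ) ≤ ((2 : ℝ) ^ hexp (0 + 1)) ^ 2 := one_le_pow₀ (one_le_pow₀ (by norm_num))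
      linarith
    · rw [hr]
      exact Nat.one_lt_two_pow_iff.mpr (by have := one_le_hexp (0 + 1); omega)
  -- the Lipschitz constant of `x ↦ x^{j+1}` on `|x| ≤ T + 1`, and the level `m`
  set Kc : ℝ := ((j : ℝ) + 1) * (T + 1) ^ j with hKc
  have hKc0 : 0 ≤ Kc := by positivity
  have hKcdiv : 0 ≤ Kc / c₀ := div_nonneg hKc0 hc₀.le
  obtain ⟨m, hm⟩ : ∃ m : ℕ, Kc / c₀ + 1 + (3 * ((j : ℝ) + 1) + 1) ≤ m := exists_nat_ge _
  have hm1 : 1 ≤ m := by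
    have : (1 : ℝ) ≤ m := by linarith
    exact_mod_cast this
  have hm3 : 3 * (j + 1) + 1 ≤ m := by
    have : ((3 * (j + 1) + 1 : ℕ) : ℝ) ≤ m := by push_cast; linarith
    exact_mod_cast this
  obtain ⟨μ, p, hμ, -, hlt⟩ := hT2 m
  have hμ1 : 1 ≤ μ := hm1.trans hμ
  set Y : ℝ := (2 : ℝ) ^ (m * μ) with hY
  set X : ℝ := (2 : ℝ) ^ (3 * (μ * (j + 1))) with hXd
  -- the rational `r = (p/2^μ)^{j+1}` and its denominator
  set r : ℚ := ((p ^ (j + 1) : ℕ) : ℚ) / ((2 ^ (μ * (j + 1)) : ℕ) : ℚ) with hr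
  have hden : r.den ≤ 2 ^ (μ * (j + 1)) := by
    have h := Rat.den_dvd ((p ^ (j + 1) : ℕ) : ℤ) ((2 ^ (μ * (j + 1)) : ℕ) : ℤ)
    rw [Rat.divInt_eq_div, Int.cast_natCast, Int.cast_natCast] at h
    have h' := Int.le_of_dvd (by exact_mod_cast Nat.two_pow_pos _) h
    exact_mod_cast h'
  have hrR : ((r : ℚ) : ℝ) = ((p : ℝ) / 2 ^ μ) ^ (j + 1) := by
    rw [hr]; push_cast; rw [div_pow, ← pow_mul]
  -- UPPER bound from the dyadic approximation
  have ha : |T| ≤ T + 1 := by rw [abs_of_pos hT0]; linarith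
  have hε1 : Real.exp (-Real.exp Y) ≤ 1 := by
    rw [Real.exp_le_one_iff]; exact neg_nonpos.mpr (Real.exp_pos _).le
  have hb : |(p : ℝ) / 2 ^ μ| ≤ T + 1 := by
    have := abs_sub_abs_le_abs_sub ((p : ℝ) / 2 ^ μ) T
    rw [abs_sub_comm, abs_of_pos hT0] at this
    linarith [hlt.le]
  have hup : |lambdaH - (r : ℝ)| ≤ Kc * Real.exp (-Real.exp Y) := by
    rw [hrR, hTJ]
    exact (abs_pow_succ_sub_le' ha hb j).trans (mul_le_mul_of_nonneg_left hlt.le (by positivity))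
  -- LOWER bound from the tree's irrationality measures of `λ_H`
  have hEX1 : Real.exp (-Real.exp X) ≤ 1 := by
    rw [Real.exp_le_one_iff]; exact neg_nonpos.mpr (Real.exp_pos _).le
  have hlow : c₀ * Real.exp (-Real.exp X) ≤ |lambdaH - (r : ℝ)| := by
    rcases Nat.lt_or_ge r.den 2 with hd | hd
    · have hd1 : r.den = 1 := by have := r.den_pos; omega
      calc c₀ * Real.exp (-Real.exp X) ≤ c₀ * 1 := mul_le_mul_of_nonneg_left hEX1 hc₀.le
        _ = c₀ := mul_one _
        _ ≤ _ := hint r hd1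
    · have h1 := lambdaH_rat_lower r hd
      have hd3 : (r.den : ℝ) ^ 3 ≤ X := by
        have : (r.den : ℝ) ≤ (2 : ℝ) ^ (μ * (j + 1)) := by exact_mod_cast hden
        calc (r.den : ℝ) ^ 3 ≤ ((2 : ℝ) ^ (μ * (j + 1))) ^ 3 := pow_le_pow_left₀ (by positivity) this 3
          _ = X := by rw [hXd, ← pow_mul, mul_comm]
      calc c₀ * Real.exp (-Real.exp X) ≤ 1 * Real.exp (-Real.exp X) :=
            mul_le_mul_of_nonneg_right hc₀1 (Real.exp_pos _).le
        _ = Real.exp (-Real.exp X) := one_mul _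
        _ ≤ Real.exp (-Real.exp ((r.den : ℝ) ^ 3)) :=
            Real.exp_le_exp.mpr (neg_le_neg (Real.exp_le_exp.mpr hd3))
        _ ≤ _ := h1
  -- `2X ≤ Y`
  have hXY : X + X ≤ Y := by
    have hnat : 3 * (μ * (j + 1)) + 1 ≤ m * μ := by
      have := Nat.mul_le_mul_right μ hm3
      nlinarith [hμ1]
    have h := pow_le_pow_right₀ (by norm_num : (1 : ℝ) ≤ 2) hnat
    rw [pow_succ] at h
    rw [hXd, hY]; linarith
  -- combine: `c₀ exp(exp Y − exp X) ≤ Kc`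
  have hchain : c₀ * Real.exp (-Real.exp X) ≤ Kc * Real.exp (-Real.exp Y) := hlow.trans hup
  have hkey : c₀ * Real.exp (Real.exp Y - Real.exp X) ≤ Kc := by
    have h := mul_le_mul_of_nonneg_right hchain (Real.exp_pos (Real.exp Y)).le
    have e1 : c₀ * Real.exp (-Real.exp X) * Real.exp (Real.exp Y) =
        c₀ * Real.exp (Real.exp Y - Real.exp X) := by
      rw [mul_assoc, ← Real.exp_add]; congr 1; congr 1; ring
    have e2 : Kc * Real.exp (-Real.exp Y) * Real.exp (Real.exp Y) = Kc := by
      rw [mul_assoc, ← Real.exp_add, neg_add_cancel, Real.exp_zero, mul_one]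
    rw [e1, e2] at h
    exact h
  -- `exp(exp Y − exp X) ≥ exp X ≥ X + 1 > X ≥ 2^μ > μ ≥ m`
  have hX0 : 0 ≤ X := by positivity
  have heX : X + 1 ≤ Real.exp X := by linarith [Real.add_one_le_exp X]
  have hdiff : X ≤ Real.exp Y - Real.exp X := by
    have h1 : Real.exp (X + X) ≤ Real.exp Y := Real.exp_le_exp.mpr hXY
    rw [Real.exp_add] at h1
    have h2 : Real.exp X * (X + 1) ≤ Real.exp X * Real.exp X :=
      mul_le_mul_of_nonneg_left heX (Real.exp_pos X).le
    nlinarith [Real.exp_pos X]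
  have hbig : X + 1 ≤ Real.exp (Real.exp Y - Real.exp X) := heX.trans (Real.exp_le_exp.mpr hdiff)
  have hXm : (m : ℝ) ≤ X := by
    have h2 : μ < 2 ^ μ := Nat.lt_two_pow_self
    have h3 : 2 ^ μ ≤ 2 ^ (3 * (μ * (j + 1))) := Nat.pow_le_pow_right (by norm_num) (by nlinarith)
    have h4 : (m : ℝ) ≤ ((2 ^ (3 * (μ * (j + 1))) : ℕ) : ℝ) := by exact_mod_cast (hμ.trans (h2.le.trans h3))
    rw [hXd]; push_cast at h4; exact h4
  have hfin : c₀ * (m : ℝ) ≤ Kc :=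
    (mul_le_mul_of_nonneg_left (hXm.trans (by linarith [hbig])) hc₀.le).trans hkey
  have hmK : Kc / c₀ + 1 ≤ m := by
    have : (0 : ℝ) ≤ 3 * ((j : ℝ) + 1) + 1 := by positivity
    linarith [hm]
  have hcm : Kc + c₀ ≤ c₀ * (m : ℝ) := by
    have h := mul_le_mul_of_nonneg_left hmK hc₀.le
    have e : c₀ * (Kc / c₀ + 1) = Kc + c₀ := by field_simp
    rw [e] at h
    exact h
  linarith

/-- **`z_U ∉ InLWClass`** (g39's class, tree `RootDecomp1ELWTransport.InLWClass`: coordinates in a doubled moment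
set `{T^j, βT^j}` of a dyadic 2-fold hyper-Liouville `T > 0`): the coordinate `iλ_H ∉ ℝ` forces `β ∉ ℝ`, so
`λ_H = T^J` — excluded by `lambdaH_ne_pow_of_dyadicHyper₂`.  HYPOTHESIS-FREE. -/
theorem not_inLWClass_zU : ¬ InLWClass zU := by
  rintro ⟨T, β, k, hT2, hT0, -, -, hsub⟩
  obtain ⟨h0, -, h2, -⟩ := zU_apply
  obtain ⟨j, hj⟩ := hsub ⟨Fin.natAdd 2 0, rfl⟩
  obtain ⟨j', hj'⟩ := hsub ⟨Fin.castAdd 2 0, rfl⟩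
  rw [h2] at hj
  rw [h0] at hj'
  have him : ∀ n : ℕ, ((T : ℂ) ^ n).im = 0 := fun n => by rw [← Complex.ofReal_pow, Complex.ofReal_im]
  have hre : ∀ n : ℕ, ((T : ℂ) ^ n).re = T ^ n := fun n => by rw [← Complex.ofReal_pow, Complex.ofReal_re]
  rcases hj with hj | hj
  · -- `i λ_H = T^{j+1}`: imaginary parts give `λ_H = 0`
    have := congrArg Complex.im hj
    rw [him, Complex.mul_im, Complex.I_re, Complex.I_im, Complex.ofReal_re, Complex.ofReal_im] at this
    simp at this
    exact lambdaH_pos'.ne' this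
  · rcases hj' with hj' | hj'
    · -- `λ_H = T^{j'+1}`: the excluded case
      have eT : lambdaH = T ^ ((j' : ℕ) + 1) := by
        apply Complex.ofReal_injective; rw [hj']; push_cast; rfl
      exact lambdaH_ne_pow_of_dyadicHyper₂ hT2 hT0 j' eT
    · -- `λ_H = β T^{j'+1}` with `β T^{j+1} = i λ_H`: real parts clash
      have e : (lambdaH : ℂ) * (T : ℂ) ^ ((j : ℕ) + 1) = I * (lambdaH : ℂ) * (T : ℂ) ^ ((j' : ℕ) + 1) := by
        calc (lambdaH : ℂ) * (T : ℂ) ^ ((j : ℕ) + 1)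
            = β * (T : ℂ) ^ ((j' : ℕ) + 1) * (T : ℂ) ^ ((j : ℕ) + 1) := by rw [← hj']
          _ = β * (T : ℂ) ^ ((j : ℕ) + 1) * (T : ℂ) ^ ((j' : ℕ) + 1) := by ring
          _ = I * (lambdaH : ℂ) * (T : ℂ) ^ ((j' : ℕ) + 1) := by rw [← hj]
      have := congrArg Complex.re e
      rw [Complex.mul_re, hre, him, Complex.ofReal_re, Complex.ofReal_im, mul_assoc, Complex.mul_re,
        Complex.I_re, Complex.I_im, Complex.mul_im, Complex.ofReal_re, Complex.ofReal_im, hre, him] at this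
      simp at this
      rcases this with h | h
      · exact lambdaH_pos'.ne' h
      · exact hT0.ne' h

/-- **SEPARATION, assembled (hypothesis-free):** `z_U` lies in none of the four decided explicit 1E classes of
record (g35 scale, g36 point, g37 two-scale, g39 LW); and the twisted-frame REPRESENTATION of its scale with
rational algebraic part collides (`zU_frame_collides`).  Whether `z_U ∈ InTwistedFrameClass` through some OTHER
representation `λ_H^{j} = θ·ρ^{e}` (θ irrational algebraic, ρ hyper-Liouville) is an OPEN Diophantine question,
stated as such (NODE §4); on any overlap this cell replaces g40's currency `hLW ∧ hRoy` by `hE`. -/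
theorem zU_separation : ¬ InPointClass zU ∧ ¬ InScaleClass zU ∧ ¬ InTwoScaleClass zU ∧ ¬ InLWClass zU ∧
    (∀ β : ℂ, ¬ LinearIndependent ℚ (zTwin 2 β (((1 : ℚ) : ℝ)))) :=
  ⟨not_inPointClass_zU, not_inScaleClass_zU, not_inTwoScaleClass_zU, not_inLWClass_zU, zU_frame_collides⟩

/-! ## §13  The member against the LIVE items 25020 / 31409 (read-backs and positional probes; the items
themselves are NOT derived — every statement below is either mod `hE`, or takes the live item as a hypothesis) -/

/-- `i` is algebraic … (copy of g40's tree one-liner `RootDecomp1EWallDichotomy02.isAlgebraic_I`, not imported here). -/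
private theorem isAlgebraic_I' : IsAlgebraic ℚ I :=
  IsAlgebraic.of_pow two_pos (by rw [Complex.I_sq]; exact isAlgebraic_one.neg)

/-- … and irrational (copy of `RootDecomp1EWallDichotomy02.I_not_mem_range`). -/
private theorem I_not_mem_range' : I ∉ Set.range (algebraMap ℚ ℂ) := by
  rintro ⟨r, hr⟩
  have := congrArg Complex.im hr
  simp at this

/-- `z_U` is ℚ-free (hypothesis-free: `λ_H` transcendental, `i` algebraic irrational; g39's tree lemma). -/
theorem linearIndependent_zU : LinearIndependent ℚ zU :=
  linearIndependent_zTwin lambdaH_transcendental isAlgebraic_I' I_not_mem_range' 2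

/-- `z_U` is E-stable with `β = i`: `i·(λ_H^j) = (iλ_H^j)` and `i·(iλ_H^j) = −λ_H^j`. -/
theorem zU_Estable : ∃ β : ℂ, IsAlgebraic ℚ β ∧ β ∉ Set.range (algebraMap ℚ ℂ) ∧
    ∀ j, β * zU j ∈ Submodule.span ℚ (Set.range zU) := by
  refine ⟨I, isAlgebraic_I', I_not_mem_range', fun j => ?_⟩
  have hm : ∀ i, zU i ∈ Submodule.span ℚ (Set.range zU) := fun i => Submodule.subset_span ⟨i, rfl⟩
  refine Fin.addCases (motive := fun j => I * zU j ∈ Submodule.span ℚ (Set.range zU))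
    (fun i => ?_) (fun i => ?_) j
  · have e : I * zU (Fin.castAdd 2 i) = zU (Fin.natAdd 2 i) := by rw [zU, zTwin_left, zTwin_right]
    rw [e]; exact hm _
  · have e : I * zU (Fin.natAdd 2 i) = (-1 : ℚ) • zU (Fin.castAdd 2 i) := by
      rw [zU, zTwin_right, zTwin_left, ← mul_assoc, Complex.I_mul_I]; simp [Algebra.smul_def]
    rw [e]; exact Submodule.smul_mem _ _ (hm _)

/-- **Item 25020 AT `z_U`** (its body at `n = 4`, `z = z_U`), proved outright mod `hE`. -/
theorem item25020_at_zU (hE : EHLM2015_thm_2_1) : LinearIndependent ℚ zU →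
    ((2 + 2 : ℕ) : Cardinal) ≤ Algebra.trdeg ℚ
      ↥(IntermediateField.adjoin ℚ (Set.range zU ∪ Set.range (Complex.exp ∘ zU))) + 1 :=
  fun hli => cell_25020 hE (2 + 2) zU hli zU_mem_gaussCurveClass

/-- **Item 31409 AT `z_U`** (its body at `n = 4`, `z = z_U`; all three binders are dischargeable —
`linearIndependent_zU`, `zU_Estable` — and the first-failure binder is not even used), proved outright mod `hE`. -/
theorem item31409_at_zU (hE : EHLM2015_thm_2_1) : LinearIndependent ℚ zU →
    (∃ β : ℂ, IsAlgebraic ℚ β ∧ β ∉ Set.range (algebraMap ℚ ℂ) ∧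
      ∀ i, β * zU i ∈ Submodule.span ℚ (Set.range zU)) →
    (∀ (m : ℕ) (w : Fin m → ℂ), m < 2 + 2 → LinearIndependent ℚ w →
      (∀ j, w j ∈ Submodule.span ℚ (Set.range zU)) →
        (m : Cardinal) ≤ Algebra.trdeg ℚ
          ↥(IntermediateField.adjoin ℚ (Set.range w ∪ Set.range (Complex.exp ∘ w))) + 1) →
    ((2 + 2 : ℕ) : Cardinal) ≤ Algebra.trdeg ℚ
      ↥(IntermediateField.adjoin ℚ (Set.range zU ∪ Set.range (Complex.exp ∘ zU))) + 1 :=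
  fun hli hEs hIH => cell_31409 hE (2 + 2) zU hli hEs hIH zU_mem_gaussCurveClass

section LiveItems

open Summit.Schanuel.Schanuel.Theses.RootDecomp1E (DefectOneSchanuel EStableDefectOne)

/-- The LIVE item 25020 restricted to the Gauss-curve class is exactly the shape `cell_25020 hE` proves
(positional probe: item ⇒ cell, trivially). -/
theorem cell_25020_of_defectOneSchanuel (h : DefectOneSchanuel) : ∀ (n : ℕ) (z : Fin n → ℂ),
    LinearIndependent ℚ z → InGaussCurveClass z →
      (n : Cardinal) ≤ Algebra.trdeg ℚ
        ↥(IntermediateField.adjoin ℚ (Set.range z ∪ Set.range (Complex.exp ∘ z))) + 1 :=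
  fun n z hli _ => h n z hli

/-- The LIVE item 31409 specialised at `z_U` (types against the live decl; `Fin (2+2) = Fin 4` silently): its
linear-independence and E-stability binders are DISCHARGED (`linearIndependent_zU`, `zU_Estable`); the
first-failure binder stays a hypothesis. -/
theorem eStableDefectOne_at_zU (h : EStableDefectOne) :
    (∀ (m : ℕ) (w : Fin m → ℂ), m < 2 + 2 → LinearIndependent ℚ w →
      (∀ j, w j ∈ Submodule.span ℚ (Set.range zU)) →
        (m : Cardinal) ≤ Algebra.trdeg ℚ
          ↥(IntermediateField.adjoin ℚ (Set.range w ∪ Set.range (Complex.exp ∘ w))) + 1) →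
    ((2 + 2 : ℕ) : Cardinal) ≤ Algebra.trdeg ℚ
      ↥(IntermediateField.adjoin ℚ (Set.range zU ∪ Set.range (Complex.exp ∘ zU))) + 1 :=
  h (2 + 2) zU linearIndependent_zU zU_Estable

/-- … and the same conclusion WITHOUT the item, mod `hE` (the first-failure binder unused). -/
theorem eStableDefectOne_body_at_zU_of_hE (hE : EHLM2015_thm_2_1) :
    (∀ (m : ℕ) (w : Fin m → ℂ), m < 2 + 2 → LinearIndependent ℚ w →
      (∀ j, w j ∈ Submodule.span ℚ (Set.range zU)) →
        (m : Cardinal) ≤ Algebra.trdeg ℚ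
          ↥(IntermediateField.adjoin ℚ (Set.range w ∪ Set.range (Complex.exp ∘ w))) + 1) →
    ((2 + 2 : ℕ) : Cardinal) ≤ Algebra.trdeg ℚ
      ↥(IntermediateField.adjoin ℚ (Set.range zU ∪ Set.range (Complex.exp ∘ zU))) + 1 :=
  fun _ => item25020_at_zU hE linearIndependent_zU

end LiveItems

end Summit.Schanuel.Schanuel.Theorems.RootDecomp1EUntwistedWall
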